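import Mathlib
import Summits.ValiantsHypothesis.ValiantsHypothesis.Theorems.FifoMatchingNNDivisionHardFewFlatsExp
import HarnessLib

/-!
# ★★★ EXPONENTIAL RATE `2^{κ√n} ≤ L₊(NN_n · hh)` ON THE PARALLEL-FLATS CLASS OF COFACTORS (crux `Theses.FifoMatching.NNDivisionHard`,
# stmt-ValiantsHypothesis-21181; the rate wanted by the sibling crux `NNNotVP`'s stub B2 ≡ exponential division hardness)

WHAT IS NEW.  ✓ `…FewFlatsExp.nnDivisionHard_fewFlatsExp` decides, at the ROUTE rate `2^((log₂ n + c)^c)`, the cofactors whose Newton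
polytope is generated by points on at most `2^{κ√n}` parallel translates of a direction space of dimension `≤ κ√n` (containing the
generator-count tier and the coordinate dimension tier, and the products `p·q` of a few-nomial and a low-dimensional factor that
neither tier decides).  This file gives the same class at the EXPONENTIAL rate, as ✓ `…FewGeneratorsExp.nn_complexity_expLowerBound_fewGenerators`
does for the count tier:

* ★ `nn_passenger_three_pow_le_flats` — PROP A + DIMENSION RUNG read on `NN_n` through the transport WITH the flat structure:
  some `h ≥ c·g` and `d ≤ dim V` have `3^{h−d} ≤ |T| · (s + 1) · 2^{h−d}` for every size-`s` extended formulation of `Newt(NN_n) + conv q₀`.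
* ★★★ `nn_complexity_expLowerBound_fewFlats` — `∃ κ > 0`, eventually in `n`: `|T| ≤ 2^{κ√n}` flats of dimension `≤ κ√n` ⇒
  `2^{κ√n} ≤ L₊(NN_n · hh)`; ★★★ `nn_complexity_expLowerBound_mul` — the member `hh = p · q`, `|supp p| ≤ 2^{κ√n}`, `dim aff supp q ≤ κ√n`.

MECHANISM: ✓ `transport_geometric_flats` + ✓ `corPolytopeGraph_top_add_hull_three_pow_le_of_flats`, then the rate plumbing of
✓ `nn_complexity_expLowerBound_fewGenerators` verbatim with `h ↦ h − d` (`16x ≤ h`, `d ≤ x` ⇒ `8x ≤ h − d`).  No definitions, no named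
facts, no sorry.

HONEST FRAMING: a restriction theorem (a decided sub-class of cofactors at exponential rate), NOT the crux: stmt-21181 `NNDivisionHard`
OPEN; exponential division hardness of `NN` (B2) OPEN; `NNNotVP` OPEN; `VP ≠ VNP` NOT proved; nothing here is a summit statement.
References: Hrubeš–Yehudayoff 2021 §6 Problem 2 [HrubesYehudayoff2021]; Fiorini et al. 2015 Thm 7 [FioriniEtAl2015]; Kaibel–Weltge 2015
Thm 1 [KaibelWeltge2014].
-/

set_option autoImplicit false

-- the mandated summit-side namespace repeats a component by design (single-problem summit)
set_option linter.dupNamespace false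

noncomputable section

open Matrix Finset
open scoped Pointwise

namespace Summit.ValiantsHypothesis.ValiantsHypothesis.Theorems.FifoMatching

namespace FewFlats

open Literature.Barriers.PneNP (HasEFOfSize)
open Literature.Combinatorics.Optimization (corPolytopeGraph)
open Summit.ValiantsHypothesis.ValiantsHypothesis.Theorems.FifoMatching.XcDivision
open Summit.ValiantsHypothesis.ValiantsHypothesis.Theorems.FifoMatching.LowDim (adim)
open MvPolynomial
open scoped NNReal
open Literature.Computability.AlgebraicComplexity (complexity nestFreeMatchingPoly)
open Literature.Computability.AlgebraicComplexity.MonotoneCircuitEF (hasEFOfSize_newtonPolytope_complexity)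
open Literature.Algebra.Polynomial.NewtonPolytope (newtonPolytope newtonPolytope_mul)
open Summit.ValiantsHypothesis.ValiantsHypothesis.Theorems.FifoMatching.QueueGridFace (realOf suppPts newt)
open Summit.ValiantsHypothesis.ValiantsHypothesis.Theorems.FifoMatching.MonomialCofactor (newt_eq_newtonPolytope)

/-- ★ **PROP A + DIMENSION RUNG READ ON `NN_n`, FOR A PASSENGER ON LABELLED PARALLEL FLATS (explicit form, PROVED):** with AFHMS's
constants `c, t₀`: for `r ≥ 1`, `n ≥ (r+1)(2r+1)`, `2g ≤ r`, `g ≥ t₀`, every passenger `conv{q₀ j}` labelled by `π : J → T` with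
equal-label differences in `V`, and every size-`s` extended formulation of `Newt(NN_n) + conv{q₀}`: some `h ≥ c·g` and `d ≤ dim V` have
`3^{h−d} ≤ |T| · (s + 1) · 2^{h−d}`. [cite: FioriniEtAl2015, Thm. 7] [cite: KaibelWeltge2014, Thm. 1] -/
theorem nn_passenger_three_pow_le_flats :
    ∃ c : ℝ, 0 < c ∧ ∃ t₀ : ℕ, ∀ (n r g : ℕ), 1 ≤ r → (r + 1) * (2 * r + 1) ≤ n → 2 * g ≤ r → t₀ ≤ g →
      ∀ {J T : Type} [Fintype J] [Nonempty J] [Fintype T] (q₀ : J → (Fin (2 * n) × Fin (2 * n)) → ℝ) (π : J → T)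
        (V : Submodule ℝ ((Fin (2 * n) × Fin (2 * n)) → ℝ)), (∀ j j', π j = π j' → q₀ j - q₀ j' ∈ V) → ∀ (s : ℕ),
        HasEFOfSize (newtonPolytope (MvPolynomial.map NNReal.toRealHom (nestFreeMatchingPoly n ℝ≥0)) +
          convexHull ℝ (Set.range q₀)) s →
          ∃ h : ℕ, c * g ≤ h ∧ ∃ d : ℕ, d ≤ Module.finrank ℝ ↥V ∧
            3 ^ (h - d) ≤ Fintype.card T * (s + 1) * 2 ^ (h - d) := by
  obtain ⟨c, hc, t₀, H⟩ := transport_geometric_flats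
  refine ⟨c, hc, t₀, fun n r g hr hn hg ht J T _ _ _ q₀ π V hV s hEF => ?_⟩
  classical
  have hEF' : HasEFOfSize (newt (nestFreeMatchingPoly n ℝ≥0) + convexHull ℝ (Set.range q₀)) s := by
    rw [newt_eq_newtonPolytope]; exact hEF
  obtain ⟨h, hch, K, q, π', V', hq, hV', hdV'⟩ := H n r g hr hn hg ht q₀ π V hV s hEF'
  exact ⟨h, hch, Module.finrank ℝ ↥V', hdV',
    corPolytopeGraph_top_add_hull_three_pow_le_of_flats q π' V' hV' hq⟩

set_option maxHeartbeats 400000 in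
/-- ★★★ **EXPONENTIAL RATE ON THE PARALLEL-FLATS CLASS (PROVED, unconditional):** there is `κ > 0` such that, eventually in `n`, every
cofactor `hh ≠ 0` over `ℝ≥0` whose Newton polytope is the hull of a family `q₀` labelled by `π : J → T`, `|T| ≤ 2^{κ·√n}`, with
equal-label differences in a space `V` of dimension `≤ κ·√n`, has `2^{κ·√n} ≤ L₊(NN_n · hh)` — any degrees, any number of monomials or
vertices, any Newton dimension. [cite: HrubesYehudayoff2021, §6 Problem 2] [cite: FioriniEtAl2015, Thm. 7] [cite: KaibelWeltge2014, Thm. 1] -/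
theorem nn_complexity_expLowerBound_fewFlats : ∃ κ : ℝ, 0 < κ ∧ ∃ n₀ : ℕ, ∀ n ≥ n₀,
    ∀ hh : MvPolynomial (Fin (2 * n) × Fin (2 * n)) ℝ≥0, hh ≠ 0 →
      ∀ {J T : Type} [Fintype J] [Nonempty J] [Fintype T] (q₀ : J → (Fin (2 * n) × Fin (2 * n)) → ℝ)
        (π : J → T) (V : Submodule ℝ ((Fin (2 * n) × Fin (2 * n)) → ℝ)),
        newtonPolytope (MvPolynomial.map NNReal.toRealHom hh) = convexHull ℝ (Set.range q₀) →
        (∀ j j', π j = π j' → q₀ j - q₀ j' ∈ V) →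
        (Fintype.card T : ℝ) ≤ (2 : ℝ) ^ (κ * Real.sqrt n) →
        (Module.finrank ℝ ↥V : ℝ) ≤ κ * Real.sqrt n →
          (2 : ℝ) ^ (κ * Real.sqrt n) ≤ (complexity (nestFreeMatchingPoly n ℝ≥0 * hh) : ℝ) := by
  obtain ⟨cA, hcA, t₀, hexp⟩ := nn_passenger_three_pow_le_flats
  set cm : ℝ := min cA 1 with hcm
  have hcm0 : 0 < cm := lt_min hcA one_pos
  have hcmA : cm ≤ cA := min_le_left _ _
  have hcm1 : cm ≤ 1 := min_le_right _ _
  obtain ⟨S₁, hS₁⟩ := exists_nat_ge ((20 / cm) ^ 2)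
  obtain ⟨S₀, hS₀a, hS₀c, hS₀d⟩ : ∃ S₀ : ℕ, 4 * t₀ + 4 ≤ S₀ ∧ S₁ ≤ S₀ ∧ 16 ≤ S₀ :=
    ⟨4 * t₀ + 4 + S₁ + 16, by omega, by omega, by omega⟩
  refine ⟨cm / 128, by positivity, S₀ ^ 2, fun n hn hh hh0 J T _ _ _ q₀ π V hQ hV hcard hdimV => ?_⟩
  obtain ⟨s, hs⟩ : ∃ s, s = Nat.sqrt n := ⟨_, rfl⟩
  have hsS : S₀ ≤ s := by rw [hs]; exact Nat.le_sqrt'.2 hn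
  have hss : s ^ 2 ≤ n := by rw [hs]; exact Nat.sqrt_le' n
  have hns : n < (s + 1) ^ 2 := by rw [hs]; exact Nat.lt_succ_sqrt' n
  obtain ⟨g, hg⟩ : ∃ g, g = s / 4 := ⟨_, rfl⟩
  have h4g : 4 * g ≤ s := by rw [hg]; exact Nat.mul_div_le s 4
  have hg4 : s < 4 * (g + 1) := by rw [hg]; omega
  have hg1 : 1 ≤ g := by omega
  have hgt : t₀ ≤ g := by omega
  have hn' : (2 * g + 1) * (2 * (2 * g) + 1) ≤ n := by nlinarith [Nat.mul_le_mul h4g h4g]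
  set L : ℕ := complexity (nestFreeMatchingPoly n ℝ≥0 * hh) with hL
  have hEF : HasEFOfSize (newtonPolytope (MvPolynomial.map NNReal.toRealHom (nestFreeMatchingPoly n ℝ≥0)) +
      convexHull ℝ (Set.range q₀)) (3 * L) := by
    have h1 := hasEFOfSize_newtonPolytope_complexity (nestFreeMatchingPoly n ℝ≥0 * hh)
    rw [map_mul, newtonPolytope_mul, hQ] at h1
    exact h1
  obtain ⟨h, hch, d, hdV, hA⟩ := hexp n (2 * g) g (by omega) hn' (le_refl _) hgt q₀ π V hV (3 * L) hEF
  set x : ℝ := cm / 128 * Real.sqrt n with hx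
  have hg_real : (s : ℝ) / 4 - 1 ≤ g := by
    have : (s : ℝ) < 4 * ((g : ℝ) + 1) := by exact_mod_cast hg4
    linarith
  have h1 : cm * ((s : ℝ) / 4 - 1) ≤ h :=
    calc cm * ((s : ℝ) / 4 - 1) ≤ cm * g := mul_le_mul_of_nonneg_left hg_real hcm0.le
      _ ≤ cA * g := mul_le_mul_of_nonneg_right hcmA (Nat.cast_nonneg g)
      _ ≤ h := hch
  have hsqn : Real.sqrt n ≤ (s : ℝ) + 1 := by
    calc Real.sqrt n ≤ Real.sqrt (((s : ℝ) + 1) ^ 2) :=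
          Real.sqrt_le_sqrt (by exact_mod_cast hns.le)
      _ = (s : ℝ) + 1 := Real.sqrt_sq (by positivity)
  have hs16 : (16 : ℝ) ≤ s := by exact_mod_cast (show 16 ≤ s by omega)
  have hx16 : 16 * x ≤ h := by
    have e1 : cm / 128 * Real.sqrt n ≤ cm / 128 * ((s : ℝ) + 1) :=
      mul_le_mul_of_nonneg_left hsqn (by positivity)
    rw [hx]
    nlinarith
  have hx1 : 1 ≤ x := by
    have hS₁s : ((20 / cm) ^ 2 : ℝ) ≤ s := le_trans hS₁ (by exact_mod_cast (show S₁ ≤ s by omega))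
    have hsn : (s : ℝ) ≤ Real.sqrt n := by
      calc (s : ℝ) = Real.sqrt ((s : ℝ) ^ 2) := (Real.sqrt_sq (by positivity)).symm
        _ ≤ Real.sqrt n := Real.sqrt_le_sqrt (by exact_mod_cast hss)
    have h128 : 128 / cm ≤ (20 / cm) ^ 2 := by
      rw [div_pow, div_le_div_iff₀ hcm0 (by positivity)]
      nlinarith
    have : 128 / cm ≤ Real.sqrt n := h128.trans (hS₁s.trans hsn)
    rw [hx]
    have := mul_le_mul_of_nonneg_left this (show (0 : ℝ) ≤ cm / 128 by positivity)
    rwa [show cm / 128 * (128 / cm) = 1 by field_simp] at this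
  -- the level `m = h - d` still has `8x ≤ m`
  have hdx : (d : ℝ) ≤ x := le_trans (by exact_mod_cast hdV) hdimV
  have hdh : d ≤ h := by
    have : (d : ℝ) ≤ h := by linarith
    exact_mod_cast this
  set m : ℕ := h - d with hm
  have hmR : (m : ℝ) = (h : ℝ) - d := by rw [hm, Nat.cast_sub hdh]
  have hx8 : 8 * x ≤ m := by rw [hmR]; linarith
  have hAR : ((3 : ℝ) / 2) ^ m ≤ (Fintype.card T : ℝ) * (3 * (L : ℝ) + 1) := by
    have : ((3 ^ m : ℕ) : ℝ) ≤ ((Fintype.card T * (3 * L + 1) * 2 ^ m : ℕ) : ℝ) := by exact_mod_cast hA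
    push_cast at this
    rw [div_pow, div_le_iff₀ (by positivity)]
    linarith
  have hhalf : (2 : ℝ) ^ ((1 / 2 : ℝ) * (m : ℝ)) ≤ ((3 : ℝ) / 2) ^ m := by
    rw [Real.rpow_mul (by norm_num), Real.rpow_natCast]
    refine pow_le_pow_left₀ (by positivity) ?_ _
    rw [← Real.sqrt_eq_rpow]
    calc Real.sqrt 2 ≤ Real.sqrt (((3 : ℝ) / 2) ^ 2) := Real.sqrt_le_sqrt (by norm_num)
      _ = 3 / 2 := Real.sqrt_sq (by norm_num)
  have h4x : (2 : ℝ) ^ (4 * x) ≤ (2 : ℝ) ^ ((1 / 2 : ℝ) * (m : ℝ)) :=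
    Real.rpow_le_rpow_of_exponent_le (by norm_num) (by linarith)
  have hsplit : (2 : ℝ) ^ (4 * x) = (2 : ℝ) ^ x * (2 : ℝ) ^ (3 * x) := by
    rw [← Real.rpow_add (by norm_num)]; ring_nf
  have h2x : (0 : ℝ) < (2 : ℝ) ^ x := by positivity
  have h3x : (2 : ℝ) ^ (3 * x) ≤ 3 * (L : ℝ) + 1 := by
    have hchain : (2 : ℝ) ^ x * (2 : ℝ) ^ (3 * x) ≤ (2 : ℝ) ^ x * (3 * (L : ℝ) + 1) := by
      calc (2 : ℝ) ^ x * (2 : ℝ) ^ (3 * x) = (2 : ℝ) ^ (4 * x) := hsplit.symm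
        _ ≤ ((3 : ℝ) / 2) ^ m := h4x.trans hhalf
        _ ≤ (Fintype.card T : ℝ) * (3 * (L : ℝ) + 1) := hAR
        _ ≤ (2 : ℝ) ^ x * (3 * (L : ℝ) + 1) := mul_le_mul_of_nonneg_right hcard (by positivity)
    exact le_of_mul_le_mul_left hchain h2x
  set y : ℝ := (2 : ℝ) ^ x with hy
  have hy2 : 2 ≤ y := by
    calc (2 : ℝ) = (2 : ℝ) ^ (1 : ℝ) := (Real.rpow_one 2).symm
      _ ≤ (2 : ℝ) ^ x := Real.rpow_le_rpow_of_exponent_le (by norm_num) hx1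
  have hy3 : y ^ 3 ≤ 3 * (L : ℝ) + 1 := by
    have : (2 : ℝ) ^ (3 * x) = y ^ 3 := by
      rw [hy, ← Real.rpow_natCast, ← Real.rpow_mul (by norm_num)]; ring_nf
    rw [← this]; exact h3x
  by_contra hlt
  push Not at hlt
  nlinarith [hy2, hy3, hlt, mul_le_mul_of_nonneg_left hy2 (by linarith : (0 : ℝ) ≤ y)]

/-- ★★★ **EXPONENTIAL RATE FOR PRODUCTS OF A FEW-NOMIAL AND A LOW-DIMENSIONAL COFACTOR (PROVED, unconditional):** `∃ κ > 0`, eventually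
in `n`, every product `p · q ≠ 0` over `ℝ≥0` with `|supp p| ≤ 2^{κ·√n}` and `dim aff supp q ≤ κ·√n` has `2^{κ·√n} ≤ L₊(NN_n · (p·q))` —
any degrees of `p` and `q`. [cite: HrubesYehudayoff2021, §6 Problem 2] [cite: KaibelWeltge2014, Thm. 1] -/
theorem nn_complexity_expLowerBound_mul : ∃ κ : ℝ, 0 < κ ∧ ∃ n₀ : ℕ, ∀ n ≥ n₀,
    ∀ p q : MvPolynomial (Fin (2 * n) × Fin (2 * n)) ℝ≥0, p * q ≠ 0 →
      (p.support.card : ℝ) ≤ (2 : ℝ) ^ (κ * Real.sqrt n) → (adim (suppPts q) : ℝ) ≤ κ * Real.sqrt n →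
        (2 : ℝ) ^ (κ * Real.sqrt n) ≤ (complexity (nestFreeMatchingPoly n ℝ≥0 * (p * q)) : ℝ) := by
  obtain ⟨κ, hκ, n₀, hn₀⟩ := nn_complexity_expLowerBound_fewFlats
  refine ⟨κ, hκ, n₀, fun n hn p q hpq hcard hdim => ?_⟩
  classical
  have hp0 : p ≠ 0 := left_ne_zero_of_mul hpq
  have hq0 : q ≠ 0 := right_ne_zero_of_mul hpq
  haveI : Nonempty p.support := (MvPolynomial.support_nonempty.2 hp0).coe_sort
  haveI : Nonempty q.support := (MvPolynomial.support_nonempty.2 hq0).coe_sort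
  have hS : suppPts q = Set.range fun b : q.support => realOf (σ := Fin (2 * n) × Fin (2 * n)) b.1 := by
    unfold suppPts; rw [Set.image_eq_range]; rfl
  refine hn₀ n hn (p * q) hpq
    (fun ab : p.support × q.support =>
      realOf (σ := Fin (2 * n) × Fin (2 * n)) ab.1.1 + realOf (σ := Fin (2 * n) × Fin (2 * n)) ab.2.1)
    (fun ab => ab.1) (vectorSpan ℝ (suppPts q)) (newtonPolytope_mul_eq_convexHull_range p q) ?_ ?_ hdim
  · intro a b hab
    rw [hS]
    exact add_flats (fun a : p.support => realOf (σ := Fin (2 * n) × Fin (2 * n)) a.1)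
      (fun b : q.support => realOf (σ := Fin (2 * n) × Fin (2 * n)) b.1) a b hab
  · rwa [Fintype.card_coe]

end FewFlats

end Summit.ValiantsHypothesis.ValiantsHypothesis.Theorems.FifoMatching

end
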